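import Literature.Computability.Complexity.AverageCaseDepthHierarchyLevel
import Literature.Computability.Complexity.AverageCaseDepthHierarchy
import HarnessLib

/-!
# The stage-wise random projection `Ψ` of Rossman–Servedio–Tan and its completion to uniform

B. Rossman, R. A. Servedio, L.-Y. Tan, *An average-case depth hierarchy theorem for Boolean
circuits*, arXiv:1504.03398 [RossmanServedioTan2015]: §6 (p. 15, the addressing scheme
`A_k = A_{k-1} × [w_{k-1}]` and Definition 5, the truncated formulas `Sipser_d^{(k)}`), §7.2
(Definition 7, the lift `τ̂`; Definition 10, `Ψ(f) = proj_{ρ^{(2)}} ⋯ proj_{ρ^{(d)}} f` with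
`ρ^{(k)} ← R(ρ̂^{(k+1)})`), §8 Propositions 1–2 (pp. 20–23: the composition of the projections
completes to the uniform distribution), §10.2 Facts 7–8 and Proposition 12 (pp. 34–35:
`proj_ρ Sipser^{(k)} ≡ Sipser^{(k-1)} ↾ ρ̂`).

## The formalisation

* `Blk W j` — the addresses of the depth-`j` gates (`Blk W 0 = Unit` is the root,
  `Blk W (j+1) = Blk W j × Fin (W j)`; RST's `A_j` for the fan-in sequence `W`); the level-`(j+1)`
  variables are `Blk W (j+1)`, a restriction of them is `BRestr (Blk W j) (Fin (W j))` (blocks =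
  depth-`j` gates), and `liftR o ρ` is RST's lift (Def. 7) for gates of non-controlling value `o`.
* `gate`, `sipserK` — the read-once formulas `Sipser^{(k)}` over `Blk W k` (Def. 5) for a polarity
  sequence `o` (`o j = true` iff the depth-`j` gates are `∧`); `sipserK_expand` is Fact 8
  (`proj_ρ Sipser^{(k+1)} = Sipser^{(k)} ↾ ρ̂`, an identity of Boolean functions).
* `ProcParams` (`W`, one `BlockLaw` per stage) and **the process as a recursion, without a joint
  law**: `V P j τ F G` is the probability that `F` and `G` (functions of the level-`(j+1)`
  variables) disagree at the end of the process run from stage `j` at the restriction `τ`: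
  `V P 0 τ F G = P_{Z ∼ plaw τ}[F Z ≠ G Z]` and
  `V P (j+1) τ F G = Σ_ρ R(τ)(ρ) · V P j (ρ̂) (F ∘ expand ρ) (G ∘ expand ρ)` (Def. 10 read backwards).
* `V_eq_plaw` — **completion to the product law** (RST Props. 1–2): for consistent parameters
  (alternating polarities, `t'` of a stage = `t` of the next), `V P j τ F G = P_{Z ∼ plaw_j(τ)}[F ≠ G]`
  for every `j`; with `τ = ⋆` and `t = 1/2` at the top stage the right-hand side is the uniform
  disagreement probability (`V_top_eq_uniform`), which is Prop. 1.

* **Bridge to the statement's objects** (`AverageCaseDepthHierarchy.lean`): the fact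
  `rossmanServedioTan2015_thm1_inRegime` is stated over `Addr ws` (ROOT-first nesting
  `Addr (w :: ws) = Fin w × Addr ws`) and `sipserEval` / `balancedSipser`. The process peels the
  BOTTOM layer at every stage, which is why this file nests leaf-inward
  (`Blk W (j+1) = Blk W j × Fin (W j)`); the two are the same finite product in opposite
  association: `fanList W d = [W 0, …, W (d-1)]` (`fanList_eq_ofFn`), `blkEquivAddr d W :
  Blk W d ≃ Addr (fanList W d)` (via `plant`/`unplant`, reading an address root-first), and
  `sipserEval_fanList : sipserEval (fanList W d) isAnd v = sipserK o d (v ∘ blkEquivAddr d W)` for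
  the polarity sequence `o j = isAnd` iff `j` is even (`sipserK_succ_root` is the root-first
  recursion of `sipserK`). With `rstFanins m d = fanList (rstWseq m d) d` (`rstFanins_eq_fanList`)
  this gives `balancedSipser_eq_sipserK`: RST's `Sipser_d` IS `sipserK` of the RST fan-ins and
  polarities, transported along `blkEquivRst m d : Blk (rstWseq m d) d ≃ Addr (rstFanins m d)`.
  The final brick transports circuits over `Addr (rstFanins m d)` along the same equivalence.

Everything is proved; the numerical parameters are arbitrary here.
-/

noncomputable section

namespace Literature.Computability.Complexity

namespace RSTProj

open Finset

/-! ### Addresses -/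

/-- The addresses of the depth-`j` gates of a depth-regular formula with fan-in sequence `W`
(`W j` = fan-in at depth `j`): the root, and (address of the parent, index among its children).
RST's `A_0 = {output}`, `A_j = A_{j-1} × [w_{j-1}]`. [cite: RossmanServedioTan2015, §6 (p. 15, addressing scheme)] -/
def Blk (W : ℕ → ℕ) : ℕ → Type
  | 0 => Unit
  | j + 1 => Blk W j × Fin (W j)

namespace Blk

variable (W : ℕ → ℕ)

/-- Addresses form a finite type. [folklore] -/
instance instFintype : (j : ℕ) → Fintype (Blk W j)
  | 0 => inferInstanceAs (Fintype Unit)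
  | j + 1 => haveI := instFintype j; inferInstanceAs (Fintype (Blk W j × Fin (W j)))

/-- Addresses have decidable equality. [folklore] -/
instance instDecidableEq : (j : ℕ) → DecidableEq (Blk W j)
  | 0 => inferInstanceAs (DecidableEq Unit)
  | j + 1 => haveI := instDecidableEq j; inferInstanceAs (DecidableEq (Blk W j × Fin (W j)))

/-- The root is the only depth-`0` address. [folklore] -/
instance instUnique : Unique (Blk W 0) := inferInstanceAs (Unique Unit)

/-- `|A_j| = ∏_{i<j} w_i`. [cite: RossmanServedioTan2015, §6 (p. 15, "`|A_d| = n`")] -/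
theorem card : ∀ j : ℕ, Fintype.card (Blk W j) = ∏ i ∈ Finset.range j, W i
  | 0 => rfl
  | j + 1 => by
    rw [Finset.prod_range_succ, ← card j]
    exact Fintype.card_prod _ _ |>.trans (by rw [Fintype.card_fin])

end Blk

/-! ### Gates, lifts and the truncated Sipser formulas -/

/-- A gate with non-controlling value `o` (`∧` for `o = 1`, `∨` for `o = 0`): it outputs `!o` iff
some input is `!o`. [cite: RossmanServedioTan2015, §6 (p. 15)] -/
def gate (o : Bool) {w : ℕ} (v : Fin w → Bool) : Bool := if ∃ i, v i = !o then !o else o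

/-- `gate true` is the conjunction. [folklore] -/
theorem gate_true_eq {w : ℕ} (v : Fin w → Bool) : gate true v = decide (∀ i, v i = true) := by
  unfold gate
  by_cases h : ∃ i, v i = !true
  · rw [if_pos h]
    obtain ⟨i, hi⟩ := h
    symm; rw [Bool.not_true, decide_eq_false_iff_not]
    intro hall; rw [hall i] at hi; exact Bool.noConfusion hi
  · rw [if_neg h]
    symm; rw [decide_eq_true_eq]
    intro i
    cases hv : v i
    · exact absurd ⟨i, by rw [hv]; rfl⟩ h
    · rfl

/-- `gate false` is the disjunction. [folklore] -/
theorem gate_false_eq {w : ℕ} (v : Fin w → Bool) : gate false v = decide (∃ i, v i = true) := by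
  unfold gate
  by_cases h : ∃ i, v i = !false
  · rw [if_pos h]; symm; simpa using h
  · rw [if_neg h]; symm; simpa using h

/-- The lift of a block string: the value of the gate (non-controlling value `o`) when its inputs
are set by the string — `!o` if some input is `!o`, `o` if all inputs are `o`, `⋆` otherwise
(RST Def. 7, in `{0,1}` rather than `{•,∘}` notation). [cite: RossmanServedioTan2015, §7.2 Def. 7 (p. 17)] -/
def liftBlock (o : Bool) {w : ℕ} (ϱ : Fin w → Option Bool) : Option Bool :=
  if ∃ i, ϱ i = some (!o) then some (!o) else if ∀ i, ϱ i = some o then some o else none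

/-- **The lift is the projected gate**: the gate applied to the expanded inputs of a block is the
lifted value, read with the block's new variable. [cite: RossmanServedioTan2015, §7.2 (p. 17, discussion after Def. 7) and §10.2 Fact 8 (p. 34)] -/
theorem gate_expand (o : Bool) {w : ℕ} (ϱ : Fin w → Option Bool) (y : Bool) :
    gate o (fun i => (ϱ i).getD y) = (liftBlock o ϱ).getD y := by
  unfold gate liftBlock
  beta_reduce
  by_cases h1 : ∃ i, ϱ i = some (!o)
  · have hv : ∃ i, (ϱ i).getD y = !o := by
      obtain ⟨i, hi⟩ := h1; exact ⟨i, by rw [hi]; rfl⟩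
    rw [if_pos hv, if_pos h1]; rfl
  · rw [if_neg h1]
    by_cases h2 : ∀ i, ϱ i = some o
    · have hv : ¬ ∃ i, (ϱ i).getD y = !o := by
        rintro ⟨i, hi⟩
        rw [h2 i] at hi
        change o = !o at hi
        cases o <;> exact Bool.noConfusion hi
      rw [if_neg hv, if_pos h2]; rfl
    · rw [if_neg h2]
      change _ = y
      by_cases hy : y = !o
      · rw [if_pos]
        · exact hy.symm
        · push Not at h2
          obtain ⟨i, hi⟩ := h2
          refine ⟨i, ?_⟩
          cases hϱ : ϱ i with
          | none => exact hy
          | some b =>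
            exfalso
            have hb : b ≠ !o := fun hb => h1 ⟨i, by rw [hϱ, hb]⟩
            have hb' : b ≠ o := fun hb' => hi (by rw [hϱ, hb'])
            cases b <;> cases o <;> simp_all
      · rw [if_neg]
        · cases y <;> cases o <;> simp_all
        · rintro ⟨i, hi⟩
          cases hϱ : ϱ i with
          | none => rw [hϱ] at hi; exact hy hi
          | some b => rw [hϱ] at hi; exact h1 ⟨i, by rw [hϱ]; exact congrArg some hi⟩

/-- The lift of a level restriction (RST `ρ̂`), as a restriction of the previous level: the value of
the depth-`j` gate `(a, i)` under `ρ`. [cite: RossmanServedioTan2015, §7.2 Def. 7 (p. 17)] -/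
def liftR (o : Bool) {W : ℕ → ℕ} {j : ℕ} (ρ : BRestr (Blk W (j + 1)) (Fin (W (j + 1)))) :
    BRestr (Blk W j) (Fin (W j)) :=
  fun a i => liftBlock o (ρ (a, i))

/-- Overwrite an assignment by the fixed values of a restriction (`f ↾ τ = f ∘ ovw τ`). [cite: RossmanServedioTan2015, §5.3 Def. 1 (p. 13, `x ↾ ρ`)] -/
def ovw {W : ℕ → ℕ} {j : ℕ} (τ : BRestr (Blk W j) (Fin (W j))) (x : Blk W (j + 1) → Bool) : Blk W (j + 1) → Bool :=
  fun v => (τ v.1 v.2).getD (x v)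

/-- The truncated Sipser formula `Sipser^{(k)}` over the depth-`k` addresses, for the polarity
sequence `o` (`o j` = non-controlling value of the depth-`j` gates): a leaf returns its variable,
and `Sipser^{(k+1)}(z) = Sipser^{(k)}(a ↦ gate_{o k}(i ↦ z (a, i)))`. [cite: RossmanServedioTan2015, §6 Def. 5 (p. 15)] -/
def sipserK {W : ℕ → ℕ} (o : ℕ → Bool) : (k : ℕ) → (Blk W k → Bool) → Bool
  | 0, y => y ()
  | k + 1, z => sipserK o k fun a => gate (o k) fun i => z (a, i)

/-- **Fact 8 of RST**: `proj_ρ Sipser^{(k+1)} ≡ Sipser^{(k)} ↾ ρ̂` (the projection wipes out the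
bottom gates, which become the lifted values or the new variables). [cite: RossmanServedioTan2015, §10.2 Facts 7–8 (p. 34)] -/
theorem sipserK_expand {W : ℕ → ℕ} (o : ℕ → Bool) (k : ℕ) (ρ : BRestr (Blk W k) (Fin (W k)))
    (y : Blk W k → Bool) :
    sipserK o (k + 1) (ρ.expand y) = sipserK o k (fun a => ((fun a => liftBlock (o k) (ρ a)) a).getD (y a)) := by
  show sipserK o k (fun a => gate (o k) fun i => (ρ a i).getD (y a)) = _
  congr 1
  funext a
  exact gate_expand (o k) (ρ a) (y a)

/-! ### The process -/

/-- The data of the process: the fan-in sequence and the block law of each stage (stage `j`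
restricts the level-`(j+1)` variables, blocks = depth-`j` gates; stage `d-1` is `R_init`, stage
`0` only records the polarity of the root and the final bias). [cite: RossmanServedioTan2015, §7.2 Def. 10 (p. 18)] -/
structure ProcParams where
  /-- fan-ins by depth -/
  W : ℕ → ℕ
  /-- the block law used at stage `j` -/
  law : ℕ → BlockLaw

namespace ProcParams

variable (P : ProcParams)

/-- **The process, as a backward recursion** (RST Def. 10 with Props. 1–2 in mind): `V P j τ F G` is
the probability that `F` and `G` disagree after the stages `j, j-1, …, 1` are run from the
restriction `τ` of the level-`(j+1)` variables and the surviving level-`1` variables are drawn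
from the final product law; stage `j+1` draws `ρ ∼ R(τ)` and continues from `ρ̂` with the projected
functions. (The level-`(j+1)` variables `Blk W (j+1)` are written as the product
`Blk W j × Fin (W j)` that they are.) [cite: RossmanServedioTan2015, §7.2 Def. 10 (p. 18) and §8 Prop. 1 (p. 20)] -/
def V : (j : ℕ) → BRestr (Blk P.W j) (Fin (P.W j)) → ((Blk P.W j × Fin (P.W j) → Bool) → Bool) →
    ((Blk P.W j × Fin (P.W j) → Bool) → Bool) → ℝ
  | 0, τ, F, G => ∑ Z : Blk P.W 0 → Fin (P.W 0) → Bool,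
      (P.law 0).plaw τ Z * (if F (fun v => Z v.1 v.2) = G (fun v => Z v.1 v.2) then 0 else 1)
  | j + 1, τ, F, G => ∑ ρ : BRestr (Blk P.W (j + 1)) (Fin (P.W (j + 1))),
      (P.law (j + 1)).R τ ρ *
        V j (liftR (P.law (j + 1)).o ρ) (fun x => F (BRestr.expand ρ x)) (fun x => G (BRestr.expand ρ x))

/-- Consistency of the stage laws needed for the completion to the product law: alternating
polarities, the fill bias of a stage is the star probability of the next, `0 < t ≤ 1`, `t' ≠ 0`.
[cite: RossmanServedioTan2015, §7.1 (p. 16, the choice of `t_{d-1}, …, t_1`)] -/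
structure Consistent : Prop where
  /-- alternation of gate types -/
  o_succ : ∀ j, (P.law (j + 1)).o = !(P.law j).o
  /-- the bit filling the stars at stage `j+1` is the variable of stage `j` -/
  t'_succ : ∀ j, (P.law (j + 1)).t' = (P.law j).t
  /-- star probabilities are probabilities -/
  t_pos : ∀ j, 0 < (P.law j).t
  /-- star probabilities are probabilities -/
  t_le_one : ∀ j, (P.law j).t ≤ 1
  /-- the defining relation `q t' = (1-t)^n - λ` is not void -/
  t'_ne_zero : ∀ j, (P.law (j + 1)).t' ≠ 0

/-- The per-coordinate weight of the product law `plaw` of the block law `L`. [folklore] -/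
def pw (L : BlockLaw) (c : Option Bool) (b : Bool) : ℝ :=
  match c with
  | none => if b = L.o then 1 - L.t else L.t
  | some c => if b = c then 1 else 0

/-- `plaw` is the product of the per-coordinate weights. [folklore] -/
theorem plaw_eq_prod_pw (L : BlockLaw) {j : ℕ} (τ : BRestr (Blk P.W j) (Fin (P.W j)))
    (Z : Blk P.W j → Fin (P.W j) → Bool) :
    L.plaw τ Z = ∏ a : Blk P.W j, ∏ i : Fin (P.W j), pw L (τ a i) (Z a i) := by
  classical
  rw [BlockLaw.plaw]
  refine Finset.prod_congr rfl fun a _ => ?_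
  unfold prodW
  refine Finset.prod_congr rfl fun i _ => ?_
  cases hτ : τ a i with
  | none => simp [pw, BlockLaw.L3]
  | some c => simp [pw]

/-- The fill law seen by stage `j+1`: the law of the new variable `y_a` given the block `a` of `ρ`,
namely the coordinate weight of `plaw_j` at the lifted value. [cite: RossmanServedioTan2015, §8 Prop. 2 (p. 22)] -/
def fillLaw (j : ℕ) (ϱ : Fin (P.W (j + 1)) → Option Bool) (b : Bool) : ℝ :=
  pw (P.law j) (liftBlock (P.law (j + 1)).o ϱ) b

/-- The fill law of stage `j+1` is a fill law (fresh biased bit on starred blocks). [cite: RossmanServedioTan2015, §8 Prop. 2 (p. 22)] -/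
theorem isFillLaw_fillLaw (hP : P.Consistent) (j : ℕ) : (P.law (j + 1)).IsFillLaw (P.fillLaw j) := by
  refine ⟨fun ϱ => ?_, fun ϱ hstar hnb b => ?_⟩
  · unfold fillLaw pw
    cases liftBlock (P.law (j + 1)).o ϱ with
    | none => rw [Fintype.sum_bool]; cases ho : (P.law j).o <;> simp
    | some c => rw [Fintype.sum_bool]; cases c <;> simp
  · have hlift : liftBlock (P.law (j + 1)).o ϱ = none := by
      unfold liftBlock
      rw [if_neg, if_neg]
      · intro hall; obtain ⟨i, hi⟩ := hstar; rw [hall i] at hi; exact (Option.some_ne_none _) hi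
      · rintro ⟨i, hi⟩; exact hnb i hi
    unfold fillLaw
    rw [hlift, pw, BlockLaw.bern, hP.o_succ j, hP.t'_succ j]
    cases b <;> cases ho : (P.law j).o <;> simp

/-- **Completion to the product law** (RST Props. 1–2, all stages at once): for consistent
parameters, the process run from stage `j` at `τ` makes `F` and `G` disagree with probability
exactly `P_{Z ∼ plaw_j(τ)}[F Z ≠ G Z]`. [cite: RossmanServedioTan2015, §8 Props. 1–2 (pp. 20–23)] -/
theorem V_eq_plaw (hP : P.Consistent) :
    ∀ (j : ℕ) (τ : BRestr (Blk P.W j) (Fin (P.W j))) (F G : (Blk P.W j × Fin (P.W j) → Bool) → Bool),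
      P.V j τ F G = ∑ Z : Blk P.W j → Fin (P.W j) → Bool,
        (P.law j).plaw τ Z * (if F (fun v => Z v.1 v.2) = G (fun v => Z v.1 v.2) then 0 else 1)
  | 0, τ, F, G => rfl
  | j + 1, τ, F, G => by
    classical
    show ∑ ρ : BRestr (Blk P.W (j + 1)) (Fin (P.W (j + 1))), (P.law (j + 1)).R τ ρ *
        P.V j (liftR (P.law (j + 1)).o ρ) (fun x => F (BRestr.expand ρ x)) (fun x => G (BRestr.expand ρ x)) = _
    have IH : ∀ ρ : BRestr (Blk P.W (j + 1)) (Fin (P.W (j + 1))),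
        P.V j (liftR (P.law (j + 1)).o ρ) (fun x => F (BRestr.expand ρ x)) (fun x => G (BRestr.expand ρ x)) =
          ∑ Y : Blk P.W (j + 1) → Bool, (∏ a, P.fillLaw j (ρ a) (Y a)) *
            (if F (fun v => BlockLaw.fillB ρ Y v.1 v.2) = G (fun v => BlockLaw.fillB ρ Y v.1 v.2) then 0 else 1) := by
      intro ρ
      rw [V_eq_plaw hP j]
      -- reindex `Z ↦ uncurry Z`
      rw [← (Equiv.curry (Blk P.W j) (Fin (P.W j)) Bool).sum_comp]
      refine Finset.sum_congr rfl fun Y _ => ?_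
      have hab : (BRestr.expand ρ fun v : Blk P.W j × Fin (P.W j) => (Equiv.curry (Blk P.W j) (Fin (P.W j)) Bool Y) v.1 v.2) =
          fun v : Blk P.W (j + 1) × Fin (P.W (j + 1)) => BlockLaw.fillB ρ Y v.1 v.2 := by
        funext v; rfl
      have hpl : (P.law j).plaw (liftR (P.law (j + 1)).o ρ) (Equiv.curry (Blk P.W j) (Fin (P.W j)) Bool Y) =
          ∏ a, P.fillLaw j (ρ a) (Y a) := by
        rw [P.plaw_eq_prod_pw]
        exact (Fintype.prod_prod_type' (f := fun (a : Blk P.W j) (i : Fin (P.W j)) => P.fillLaw j (ρ (a, i)) (Y (a, i)))).symm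
      rw [hab, hpl]
    rw [Finset.sum_congr rfl fun ρ _ => by rw [IH ρ]]
    exact (P.law (j + 1)).coupling_level_exp (hP.t_pos _) (hP.t_le_one _) (hP.t'_ne_zero _)
      (P.isFillLaw_fillLaw hP j) τ
      (fun X => if F (fun v => X v.1 v.2) = G (fun v => X v.1 v.2) then 0 else 1)

/-- The all-star restriction (the start of the process). [cite: RossmanServedioTan2015, §7.2 Def. 6 (p. 16)] -/
def allStar (j : ℕ) : BRestr (Blk P.W j) (Fin (P.W j)) := fun _ _ => none

/-- Under the all-star restriction with `t = 1/2` the product law is uniform. [cite: RossmanServedioTan2015, §8 Lemma 2 (p. 20)] -/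
theorem plaw_allStar_eq {j : ℕ} (h : (P.law j).t = 1 / 2) (Z : Blk P.W j → Fin (P.W j) → Bool) :
    (P.law j).plaw (P.allStar j) Z = (1 / 2) ^ Fintype.card (Blk P.W j × Fin (P.W j)) := by
  classical
  rw [P.plaw_eq_prod_pw, ← Fintype.prod_prod_type']
  have : ∀ v : Blk P.W j × Fin (P.W j), pw (P.law j) (P.allStar j v.1 v.2) (Z v.1 v.2) = 1 / 2 := by
    intro v
    simp only [allStar, pw]
    split_ifs <;> linarith
  rw [Finset.prod_congr rfl fun v _ => this v, Finset.prod_const, Finset.card_univ]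

/-- **Prop. 1 of RST** (completion to uniform): for consistent parameters with `t = 1/2` at the top
stage `j`, the process started from the all-star restriction makes `F, G` disagree with probability
the uniform disagreement probability `2^{-N} #{X : F X ≠ G X}`. [cite: RossmanServedioTan2015, §8 Prop. 1 (p. 20)] -/
theorem V_top_eq_uniform (hP : P.Consistent) {j : ℕ} (h : (P.law j).t = 1 / 2)
    (F G : (Blk P.W j × Fin (P.W j) → Bool) → Bool) :
    P.V j (P.allStar j) F G =
      ((univ.filter fun X : Blk P.W j × Fin (P.W j) → Bool => F X ≠ G X).card : ℝ) /
        2 ^ Fintype.card (Blk P.W j × Fin (P.W j)) := by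
  classical
  rw [P.V_eq_plaw hP j]
  simp_rw [P.plaw_allStar_eq h]
  rw [← Finset.mul_sum, ← (Equiv.curry (Blk P.W j) (Fin (P.W j)) Bool).sum_comp]
  have e : ∑ X : Blk P.W j × Fin (P.W j) → Bool,
      (if F (fun v => (Equiv.curry (Blk P.W j) (Fin (P.W j)) Bool X) v.1 v.2) =
          G (fun v => (Equiv.curry (Blk P.W j) (Fin (P.W j)) Bool X) v.1 v.2) then (0 : ℝ) else 1) =
      ((univ.filter fun X : Blk P.W j × Fin (P.W j) → Bool => F X ≠ G X).card : ℝ) := by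
    rw [Finset.card_filter]
    push_cast
    refine Finset.sum_congr rfl fun X _ => ?_
    have hX : (fun v : Blk P.W j × Fin (P.W j) => (Equiv.curry (Blk P.W j) (Fin (P.W j)) Bool X) v.1 v.2) = X := by
      funext v; rfl
    rw [hX]
    by_cases hFG : F X = G X <;> simp [hFG]
  rw [e, one_div, inv_pow, ← div_eq_inv_mul]

end ProcParams

/-! ### Bridge to `Addr` / `sipserEval` / `balancedSipser` of the statement file -/

section Bridge

/-- The fan-in LIST of a fan-in sequence: `[W 0, …, W (d-1)]`, built root-first so that
`Addr (fanList W (d+1)) = Fin (W 0) × Addr (fanList (W ∘ succ) d)` definitionally. [cite: RossmanServedioTan2015, §6 (p. 15, the fan-in sequence `w_0, …, w_{d-1}`)] -/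
def fanList (W : ℕ → ℕ) : ℕ → List ℕ
  | 0 => []
  | d + 1 => W 0 :: fanList (fun j => W (j + 1)) d

/-- `fanList W d = [W 0, …, W (d-1)]`. [folklore] -/
theorem fanList_eq_ofFn : ∀ (d : ℕ) (W : ℕ → ℕ), fanList W d = List.ofFn fun j : Fin d => W j
  | 0, _ => rfl
  | d + 1, W => by
    rw [fanList, fanList_eq_ofFn d, List.ofFn_succ]
    simp

/-- The length of the fan-in list is the depth. [folklore] -/
theorem length_fanList (d : ℕ) (W : ℕ → ℕ) : (fanList W d).length = d := by
  rw [fanList_eq_ofFn, List.length_ofFn]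

/-- Plant the address `b` of the subtree below the root child `i₀` into the whole tree
(leaf-inward nesting). [folklore] -/
def plant {W : ℕ → ℕ} (i₀ : Fin (W 0)) : (d : ℕ) → Blk (fun j => W (j + 1)) d → Blk W (d + 1)
  | 0, _ => ((), i₀)
  | d + 1, x => (plant i₀ d x.1, x.2)

/-- Read an address root-first: (root child, address in its subtree). [folklore] -/
def unplant {W : ℕ → ℕ} : (d : ℕ) → Blk W (d + 1) → Fin (W 0) × Blk (fun j => W (j + 1)) d
  | 0, x => (x.2, ())
  | d + 1, x => ((unplant d x.1).1, ((unplant d x.1).2, x.2))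

/-- `unplant ∘ plant = id`. [folklore] -/
theorem unplant_plant {W : ℕ → ℕ} (i₀ : Fin (W 0)) : ∀ (d : ℕ) (b : Blk (fun j => W (j + 1)) d),
    unplant d (plant i₀ d b) = (i₀, b)
  | 0, b => by cases b; rfl
  | d + 1, b => by
    show ((unplant d (plant i₀ d b.1)).1, ((unplant d (plant i₀ d b.1)).2, b.2)) = (i₀, b)
    rw [unplant_plant i₀ d b.1]
    rfl

/-- `plant ∘ unplant = id`. [folklore] -/
theorem plant_unplant {W : ℕ → ℕ} : ∀ (d : ℕ) (x : Blk W (d + 1)), plant (unplant d x).1 d (unplant d x).2 = x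
  | 0, x => by
    show (((), x.2) : Unit × Fin (W 0)) = x
    rcases x with ⟨u, i⟩; cases u; rfl
  | d + 1, x => by
    show ((plant (unplant d x.1).1 d (unplant d x.1).2, x.2) : Blk W (d + 1) × Fin (W (d + 1))) = x
    rw [plant_unplant d x.1]
    rfl

/-- The root-first reading of a leaf-inward address, as an `Addr`. [folklore] -/
def toAddr : (d : ℕ) → (W : ℕ → ℕ) → Blk W d → Addr (fanList W d)
  | 0, _, _ => ()
  | d + 1, W, x => ((unplant d x).1, toAddr d (fun j => W (j + 1)) (unplant d x).2)

/-- The leaf-inward reading of a root-first address. [folklore] -/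
def ofAddr : (d : ℕ) → (W : ℕ → ℕ) → Addr (fanList W d) → Blk W d
  | 0, _, _ => ()
  | d + 1, W, a => plant a.1 d (ofAddr d (fun j => W (j + 1)) a.2)

/-- `ofAddr ∘ toAddr = id`. [folklore] -/
theorem ofAddr_toAddr : ∀ (d : ℕ) (W : ℕ → ℕ) (x : Blk W d), ofAddr d W (toAddr d W x) = x
  | 0, _, x => by cases x; rfl
  | d + 1, W, x => by
    show plant (unplant d x).1 d (ofAddr d (fun j => W (j + 1)) (toAddr d (fun j => W (j + 1)) (unplant d x).2)) = x
    rw [ofAddr_toAddr d, plant_unplant]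

/-- `toAddr ∘ ofAddr = id`. [folklore] -/
theorem toAddr_ofAddr : ∀ (d : ℕ) (W : ℕ → ℕ) (a : Addr (fanList W d)), toAddr d W (ofAddr d W a) = a
  | 0, _, a => by cases a; rfl
  | d + 1, W, a => by
    show (((unplant d (plant a.1 d _)).1, toAddr d (fun j => W (j + 1)) (unplant d (plant a.1 d _)).2) :
      Fin (W 0) × Addr (fanList (fun j => W (j + 1)) d)) = a
    rw [unplant_plant, toAddr_ofAddr d]
    rfl

/-- **`Blk W d ≃ Addr (fanList W d)`**: leaf-inward and root-first addresses are the same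
finite product in opposite association. [cite: RossmanServedioTan2015, §6 (p. 15, addressing scheme)] -/
def blkEquivAddr (d : ℕ) (W : ℕ → ℕ) : Blk W d ≃ Addr (fanList W d) :=
  ⟨toAddr d W, ofAddr d W, ofAddr_toAddr d W, toAddr_ofAddr d W⟩

/-- **Root-first recursion of `sipserK`**: the depth-`(d+1)` formula is the root gate applied to
the depth-`d` formulas of the root's subtrees (with shifted polarities). [cite: RossmanServedioTan2015, §6 Def. 5 (p. 15)] -/
theorem sipserK_succ_root (o : ℕ → Bool) : ∀ (d : ℕ) (W : ℕ → ℕ) (z : Blk W (d + 1) → Bool),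
    sipserK (W := W) o (d + 1) z =
      gate (o 0) (fun i₀ : Fin (W 0) => sipserK (W := fun j => W (j + 1)) (fun j => o (j + 1)) d (fun b => z (plant i₀ d b)))
  | 0, W, z => rfl
  | d + 1, W, z => by
    show sipserK (W := W) o (d + 1) (fun a : Blk W (d + 1) => gate (o (d + 1)) fun i => z (a, i)) = _
    rw [sipserK_succ_root o d W]
    rfl

/-- A root `∧`/`∨` gate of `sipserEval` is `gate`. [cite: RossmanServedioTan2015, §6 (p. 15)] -/
theorem sipserEval_cons_eq_gate (w : ℕ) (ws : List ℕ) (isAnd : Bool) (v : Addr (w :: ws) → Bool) :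
    sipserEval (w :: ws) isAnd v = gate isAnd (fun i : Fin w => sipserEval ws (!isAnd) fun a => v (i, a)) := by
  cases isAnd
  · rw [gate_false_eq, Bool.eq_iff_iff, sipserEval_cons_false, decide_eq_true_iff]; rfl
  · rw [gate_true_eq, Bool.eq_iff_iff, sipserEval_cons_true, decide_eq_true_iff]; rfl

/-- The polarity sequence of an alternating formula with root type `isAnd`: the depth-`j` gates
are `∧` iff `isAnd` xor `j` odd. [cite: RossmanServedioTan2015, §6 (p. 15, "alternating")] -/
def altPol (isAnd : Bool) (j : ℕ) : Bool := if j % 2 = 0 then isAnd else !isAnd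

/-- Shifting the alternating polarities by one level flips the root type. [folklore] -/
theorem altPol_succ (isAnd : Bool) : (fun j => altPol isAnd (j + 1)) = altPol (!isAnd) := by
  funext j
  unfold altPol
  rcases Nat.mod_two_eq_zero_or_one j with h | h
  · rw [if_neg (by omega), if_pos h]
  · rw [if_pos (by omega), if_neg (by omega), Bool.not_not]

/-- **`sipserEval = sipserK`** along the bridge: the root-first read-once alternating formula on
the fan-in list is the leaf-inward `sipserK` with the alternating polarities. [cite: RossmanServedioTan2015, §6 Def. 5 (p. 15)] -/
theorem sipserEval_fanList : ∀ (d : ℕ) (W : ℕ → ℕ) (isAnd : Bool) (v : Addr (fanList W d) → Bool),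
    sipserEval (fanList W d) isAnd v = sipserK (W := W) (altPol isAnd) d (fun b => v (toAddr d W b))
  | 0, _, isAnd, v => by simp [fanList, sipserK, toAddr]
  | d + 1, W, isAnd, v => by
    show sipserEval (W 0 :: fanList (fun j => W (j + 1)) d) isAnd v = _
    rw [sipserEval_cons_eq_gate, sipserK_succ_root, altPol_succ]
    have h0 : altPol isAnd 0 = isAnd := by simp [altPol]
    rw [h0]
    congr 1
    funext i₀
    rw [sipserEval_fanList d (fun j => W (j + 1)) (!isAnd)]
    congr 1
    funext b
    show v (i₀, _) = v ((unplant d (plant i₀ d b)).1, toAddr d (fun j => W (j + 1)) (unplant d (plant i₀ d b)).2)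
    rw [unplant_plant]

/-- Transport of addresses along an equality of fan-in lists. [folklore] -/
def addrCast {l₁ l₂ : List ℕ} (h : l₁ = l₂) : Addr l₁ ≃ Addr l₂ := Equiv.cast (congrArg Addr h)

/-- `sipserEval` is invariant under transport along an equality of fan-in lists. [folklore] -/
theorem sipserEval_addrCast {l₁ l₂ : List ℕ} (h : l₁ = l₂) (isAnd : Bool) (v : Addr l₂ → Bool) :
    sipserEval l₁ isAnd (fun a => v (addrCast h a)) = sipserEval l₂ isAnd v := by
  subst h; rfl

/-- RST's fan-in SEQUENCE: `w₀` at the root, `m` at the bottom, `w` in between. [cite: RossmanServedioTan2015, §6 (p. 15)] -/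
def rstWseq (m d : ℕ) (j : ℕ) : ℕ := if j = 0 then rstW0 m d else if j + 1 = d then m else rstW m

/-- The statement file's fan-in list is the fan-in list of RST's fan-in sequence (`d ≥ 2`). [cite: RossmanServedioTan2015, §6 (p. 15)] -/
theorem rstFanins_eq_fanList {d : ℕ} (hd : 2 ≤ d) (m : ℕ) : rstFanins m d = fanList (rstWseq m d) d := by
  rw [fanList_eq_ofFn]
  apply List.ext_getElem
  · rw [length_rstFanins hd, List.length_ofFn]
  · intro j h1 h2
    rw [List.getElem_ofFn]
    simp only [rstWseq]
    unfold rstFanins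
    rcases j with _ | j
    · simp
    · rw [List.getElem_cons_succ, if_neg (Nat.succ_ne_zero j)]
      rw [length_rstFanins hd] at h1
      by_cases hlast : j + 1 + 1 = d
      · rw [if_pos hlast, List.getElem_append_right (by simp; omega)]
        simp
      · rw [if_neg hlast, List.getElem_append_left (by simp; omega)]
        simp

/-- **The bridge for RST's parameters**: `Blk (rstWseq m d) d ≃ Addr (rstFanins m d)`. [cite: RossmanServedioTan2015, §6 (p. 15)] -/
def blkEquivRst {d : ℕ} (hd : 2 ≤ d) (m : ℕ) : Blk (rstWseq m d) d ≃ Addr (rstFanins m d) :=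
  (blkEquivAddr d (rstWseq m d)).trans (addrCast (rstFanins_eq_fanList hd m).symm)

/-- **`balancedSipser` is `sipserK`**: RST's `Sipser_d` of the statement file, read through the
bridge, is the leaf-inward formula with fan-ins `rstWseq m d` and polarities
`altPol (bodd d)` (root `∧` iff `d` odd; hence bottom gates `∧`). [cite: RossmanServedioTan2015, §6 Def. 5 (p. 15)] -/
theorem balancedSipser_eq_sipserK {d : ℕ} (hd : 2 ≤ d) (m : ℕ) (x : Addr (rstFanins m d) → Bool) :
    balancedSipser m d x =
      sipserK (W := rstWseq m d) (altPol (Nat.bodd d)) d (fun b => x (blkEquivRst hd m b)) := by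
  unfold balancedSipser
  rw [← sipserEval_addrCast (rstFanins_eq_fanList hd m).symm, sipserEval_fanList]
  rfl

end Bridge

end RSTProj

end Literature.Computability.Complexity

end
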